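import Summits.ResolutionOfSingularities.KangarooAtlas.MizutaniMultiplicityBridge
import HarnessLib

/-!
# Mizutani's conjecture — separable points are vector groups; Oda's equality there

Cell topic `Summits/ResolutionOfSingularities/KangarooAtlas` (pub-rosobs); namespace
`Summit.ResolutionOfSingularities.KangarooAtlas.Mizutani`.  Companion of `MizutaniMultiplicity.lean` /
`MizutaniMultiplicityBridge.lean` (Hironaka's `U(𝔭) ∩ L_e` = `hirForms` versus Oda's `(L_B)_e` = `invForms`).
AI-written; *AI review is weaker than expert review*; not a resolution theorem.

A point `𝔭` of `ℙ^n_k` is SEPARABLE when `k`-linearly independent elements of `S/𝔭` have `k`-linearly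
independent `p`-th powers (Mac Lane's criterion: `k` and `(S/𝔭)^p` linearly disjoint over `k^p`, i.e. the residue
field of `𝔭` is separable = separably generated over `k`; this is the hypothesis of Mathlib's
`exists_isTranscendenceBasis_and_isSeparable_of_linearIndepOn_pow`, stacks 030W (2)).  For such points:

* `ker_linearCombination_pow_eq_span` — linear algebra: if `k`-independent families in a `k`-algebra `A` of
  characteristic `p` stay independent under `x ↦ x^q` (`q = p^m`), then for `ξ_0, …, ξ_n ∈ A` the coefficient
  vectors `a` with `Σ a_i ξ_i^q = 0` are exactly the `k`-span of the `F^m b`, `Σ b_i ξ_i = 0` (dimension count: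
  both sides have dimension `n + 1 − dim_k span{ξ_i}`, `finrank_span_range_pow_eq`);
* **`exponentLE_zero_of_linearIndependent_pow`** — the Hironaka subgroup scheme of a separable point is a VECTOR
  GROUP in Oda's sense: `ExponentLE k p 𝔭 0`, i.e. `(L_B)_e = k·F^e (L_B)_0` for all `e`
  (`(L_B)_0` = the linear forms in `𝔭`);
* **`hirForms_eq_invForms_of_linearIndependent_pow`** — hence, by `hirForms_eq_invForms_of_exponentLE_zero`,
  Oda's equality `U(𝔭) ∩ L_e = (L_B)_e` (Oda 1973 Prop. 2.2 (ii)) HOLDS in the tree at every separable point,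
  unconditionally.  (The inseparable points — where the exponent can be positive and Mizutani's bound has
  content — remain the open case of the converse inclusion; see the seat note HIRONAKA-BRIDGE-g3.md.)

References: [Mizutani1973HironakaGroupSchemes] Remark 1.2 ("B is a vector group iff the exponent of B equals 0");
[Oda1983HironakaGroupSchemeII] §2 (p. 1168); Mac Lane’s criterion [StacksProject, Tag 030W].
-/

open MvPolynomial Literature.AlgebraicGeometry.Resolution
  Literature.AlgebraicGeometry.Resolution.HironakaScheme

namespace Summit.ResolutionOfSingularities.KangarooAtlas.Mizutani

universe u v

/-! ## Linear algebra of `q`-th powers under Mac Lane's condition -/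

section PowSpan

variable {k : Type u} [Field k] {A : Type v} [CommRing A] [Algebra k A] (p : ℕ) [Fact p.Prime] [CharP A p]

/-- `x ∈ span_k s ⇒ x^{p^m} ∈ span_k {y^{p^m} : y ∈ s}` (Frobenius is additive and `p^m`-semilinear). [folklore] -/
theorem pow_char_pow_mem_span_image (m : ℕ) {s : Set A} {x : A} (hx : x ∈ Submodule.span k s) :
    x ^ p ^ m ∈ Submodule.span k ((fun y => y ^ p ^ m) '' s) := by
  induction hx using Submodule.span_induction with
  | mem y hy => exact Submodule.subset_span ⟨y, hy, rfl⟩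
  | zero =>
    rw [zero_pow (pow_ne_zero _ (Fact.out : p.Prime).ne_zero)]
    exact Submodule.zero_mem _
  | add x y _ _ hx hy =>
    rw [add_pow_char_pow]
    exact Submodule.add_mem _ hx hy
  | smul c x _ hx =>
    rw [smul_pow]
    exact Submodule.smul_mem _ _ hx

/-- Under Mac Lane's condition at the exponent `q = p^m` (independent families have independent `q`-th powers),
`dim_k span{ξ_i^q} = dim_k span{ξ_i}` for every finite family `ξ`. [cite: StacksProject, Tag 030W (2) (linearly independent elements have linearly independent p-th powers)] -/
theorem finrank_span_range_pow_eq {ι : Type*} [Fintype ι] (ξ : ι → A) (m : ℕ)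
    (hsep : ∀ (r : ℕ) (v : Fin r → A), LinearIndependent k v → LinearIndependent k fun i => v i ^ p ^ m) :
    Module.finrank k (Submodule.span k (Set.range fun i => ξ i ^ p ^ m)) =
      Module.finrank k (Submodule.span k (Set.range ξ)) := by
  classical
  set M := Submodule.span k (Set.range ξ) with hM
  haveI : FiniteDimensional k M := FiniteDimensional.span_of_finite k (Set.finite_range ξ)
  let b := Module.finBasis k M
  let v : Fin (Module.finrank k M) → A := fun t => (b t : A)
  have hv : LinearIndependent k v := b.linearIndependent.map' M.subtype (Submodule.ker_subtype M)
  have hvspan : Submodule.span k (Set.range v) = M := by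
    have h1 := congrArg (Submodule.map M.subtype) b.span_eq
    rw [Submodule.map_span, Submodule.map_top, Submodule.range_subtype, ← Set.range_comp] at h1
    exact h1
  have hvq : LinearIndependent k (fun t => v t ^ p ^ m) := hsep _ v hv
  have heq : Submodule.span k (Set.range fun t => v t ^ p ^ m) =
      Submodule.span k (Set.range fun i => ξ i ^ p ^ m) := by
    apply le_antisymm
    · rw [Submodule.span_le]
      rintro _ ⟨t, rfl⟩
      have ht : v t ∈ Submodule.span k (Set.range ξ) := (b t).2
      have h := pow_char_pow_mem_span_image (k := k) p m ht
      rwa [← Set.range_comp] at h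
    · rw [Submodule.span_le]
      rintro _ ⟨i, rfl⟩
      have hi : ξ i ∈ Submodule.span k (Set.range v) := by
        rw [hvspan]; exact Submodule.subset_span ⟨i, rfl⟩
      have h := pow_char_pow_mem_span_image (k := k) p m hi
      rwa [← Set.range_comp] at h
  rw [← heq, finrank_span_eq_card hvq, Fintype.card_fin]

variable [CharP k p]

/-- **Coefficient vectors killing the `q`-th powers are the span of the Frobenius of those killing the family**
(under Mac Lane's condition at `q = p^m`): `{a : Σ a_i ξ_i^q = 0} = span_k {F^m b : Σ b_i ξ_i = 0}`.
Both sides have dimension `n + 1 − dim_k span{ξ_i}` (`finrank_span_range_pow_eq`, `finrank_span_frobVec_image`)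
and `⊇` is the identity `Σ b_i^q ξ_i^q = (Σ b_i ξ_i)^q`. [cite: StacksProject, Tag 030W ((2): Mac Lane’s criterion)] -/
theorem ker_linearCombination_pow_eq_span {n : ℕ} (ξ : Fin (n + 1) → A) (m : ℕ)
    (hsep : ∀ (r : ℕ) (v : Fin r → A), LinearIndependent k v → LinearIndependent k fun i => v i ^ p ^ m) :
    LinearMap.ker (Fintype.linearCombination k fun i => ξ i ^ p ^ m) =
      Submodule.span k (frobVec k p m ''
        (LinearMap.ker (Fintype.linearCombination k ξ) : Set (Fin (n + 1) → k))) := by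
  symm
  apply Submodule.eq_of_le_of_finrank_eq
  · rw [Submodule.span_le]
    rintro _ ⟨b, hb, rfl⟩
    rw [SetLike.mem_coe, LinearMap.mem_ker, Fintype.linearCombination_apply] at hb ⊢
    have : ∑ i, frobVec k p m b i • ξ i ^ p ^ m = (∑ i, b i • ξ i) ^ p ^ m := by
      rw [sum_pow_char_pow]
      refine Finset.sum_congr rfl fun i _ => ?_
      rw [smul_pow]
      rfl
    rw [this, hb, zero_pow (pow_ne_zero _ (Fact.out : p.Prime).ne_zero)]
  · rw [finrank_span_frobVec_image]
    have h1 := LinearMap.finrank_range_add_finrank_ker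
      (Fintype.linearCombination k ξ : (Fin (n + 1) → k) →ₗ[k] A)
    have h2 := LinearMap.finrank_range_add_finrank_ker
      (Fintype.linearCombination k (fun i => ξ i ^ p ^ m) : (Fin (n + 1) → k) →ₗ[k] A)
    rw [Fintype.range_linearCombination] at h1 h2
    have h3 := finrank_span_range_pow_eq (k := k) p ξ m hsep
    omega

end PowSpan

/-! ## Separable points -/

section Separable

variable {k : Type u} [Field k] {p : ℕ} [Fact p.Prime] [CharP k p] {n : ℕ}
  {𝔭 : Ideal (MvPolynomial (Fin (n + 1)) k)} [h𝔭 : 𝔭.IsPrime]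

omit [Fact p.Prime] [CharP k p] h𝔭 in
/-- The image of an additive form in `S/𝔭` is the linear combination `Σ a_i ξ_i^{p^e}`, `ξ_i` the class of
`X_i`. [folklore] -/
theorem mk_addForm_eq_linearCombination (e : ℕ) (a : Fin (n + 1) → k) :
    Ideal.Quotient.mk 𝔭 (addForm k p e a) =
      Fintype.linearCombination k (fun i => xi k 𝔭 i ^ p ^ e) a := by
  rw [Fintype.linearCombination_apply]
  simp only [addForm, map_sum, map_mul, map_pow, xi]
  refine Finset.sum_congr rfl fun i _ => ?_
  rw [Algebra.smul_def (R := k) (A := MvPolynomial (Fin (n + 1)) k ⧸ 𝔭), ← Ideal.Quotient.mk_algebraMap,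
    MvPolynomial.algebraMap_eq]

omit h𝔭 in
/-- An invariant additive form lies in `𝔭` (take `D = id`). [cite: Oda1983HironakaGroupSchemeII, §2 (p. 1168: (L_B)_e ⊂ 𝔭 ∩ L_e)] -/
theorem addForm_mem_of_mem_invForms {e : ℕ} {a : Fin (n + 1) → k} (ha : a ∈ invForms k p 𝔭 e) :
    addForm k p e a ∈ 𝔭 := by
  have h := ha LinearMap.id ((isDiffOpLE_id (R := frobPow k p e) (A := k)).of_le (Nat.zero_le _))
  simpa using h

omit [Fact p.Prime] in
/-- `S/𝔭` has characteristic `p` (`𝔭` prime, so the quotient is a domain and `k` embeds). [folklore] -/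
theorem charP_quotient : CharP (MvPolynomial (Fin (n + 1)) k ⧸ 𝔭) p :=
  charP_of_injective_algebraMap (algebraMap k (MvPolynomial (Fin (n + 1)) k ⧸ 𝔭)).injective p

/-- **The Hironaka subgroup scheme of a separable point is a vector group** (Oda: exponent `≤ 0`): if
`k`-linearly independent finite families in `S/𝔭` have `k`-linearly independent `p`-th powers (Mac Lane's
separability of the residue field of `𝔭` over `k`), then `(L_B)_e = k·F^e (L_B)_0` for every `e`, where `(L_B)_0`
consists of the linear forms in `𝔭`.  (`⊆`: an invariant form lies in `𝔭`, i.e. `Σ a_i ξ_i^{p^e} = 0`, and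
`ker_linearCombination_pow_eq_span`; `⊇`: `F`-stability.)
[cite: Mizutani1973HironakaGroupSchemes, Remark 1.2 (vector group iff exponent 0); StacksProject Tag 030W] -/
theorem exponentLE_zero_of_linearIndependent_pow
    (hsep : ∀ (r : ℕ) (v : Fin r → MvPolynomial (Fin (n + 1)) k ⧸ 𝔭),
      LinearIndependent k v → LinearIndependent k fun i => v i ^ p) :
    ExponentLE k p 𝔭 0 := by
  haveI : CharP (MvPolynomial (Fin (n + 1)) k ⧸ 𝔭) p := charP_quotient
  -- iterate Mac Lane's condition to the exponents `p^m`
  have hsep' : ∀ (m r : ℕ) (v : Fin r → MvPolynomial (Fin (n + 1)) k ⧸ 𝔭),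
      LinearIndependent k v → LinearIndependent k fun i => v i ^ p ^ m := by
    intro m
    induction m with
    | zero => intro r v hv; simpa using hv
    | succ m ih =>
      intro r v hv
      have h := hsep r _ (ih r v hv)
      simpa only [← pow_mul, ← pow_succ] using h
  intro j _
  rw [Nat.sub_zero]
  -- `(L_B)_0` is the kernel of `b ↦ Σ b_i ξ_i`
  have hker0 : (invForms k p 𝔭 0 : Set (Fin (n + 1) → k)) =
      (LinearMap.ker (Fintype.linearCombination k (xi k 𝔭)) : Set (Fin (n + 1) → k)) := by
    ext b
    rw [SetLike.mem_coe, SetLike.mem_coe, LinearMap.mem_ker, mem_invForms_zero_iff,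
      ← Ideal.Quotient.eq_zero_iff_mem, mk_addForm_eq_linearCombination]
    simp only [pow_zero, pow_one]
  apply le_antisymm
  · intro a ha
    have hker : a ∈ LinearMap.ker (Fintype.linearCombination k fun i => xi k 𝔭 i ^ p ^ j) := by
      rw [LinearMap.mem_ker, ← mk_addForm_eq_linearCombination, Ideal.Quotient.eq_zero_iff_mem]
      exact addForm_mem_of_mem_invForms ha
    rw [ker_linearCombination_pow_eq_span p _ j (hsep' j), ← hker0] at hker
    exact hker
  · calc Submodule.span k (frobVec k p j '' (invForms k p 𝔭 0 : Set (Fin (n + 1) → k)))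
        ≤ hirForms k p 𝔭 (0 + j) := by
          rw [← hirForms_zero]; exact span_frobVec_image_hirForms_le j 0
      _ ≤ invForms k p 𝔭 j := by rw [Nat.zero_add]; exact hirForms_le_invForms 𝔭 j

/-- **Oda's equality `U(𝔭) ∩ L_e = (L_B)_e` holds at every separable point** (all levels `e`), unconditionally:
separable points are vector groups (`exponentLE_zero_of_linearIndependent_pow`) and for vector-group points the
two spaces agree (`hirForms_eq_invForms_of_exponentLE_zero`).
[cite: Oda1983HironakaGroupSchemeII, §2 (p. 1168: Oda 1973 Prop. 2.2 (ii)); Mizutani1973HironakaGroupSchemes, Remark 1.2] -/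
theorem hirForms_eq_invForms_of_linearIndependent_pow
    (hsep : ∀ (r : ℕ) (v : Fin r → MvPolynomial (Fin (n + 1)) k ⧸ 𝔭),
      LinearIndependent k v → LinearIndependent k fun i => v i ^ p) (e : ℕ) :
    hirForms k p 𝔭 e = invForms k p 𝔭 e :=
  hirForms_eq_invForms_of_exponentLE_zero (exponentLE_zero_of_linearIndependent_pow hsep) e

end Separable

end Summit.ResolutionOfSingularities.KangarooAtlas.Mizutani
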